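import Summits.BirchSwinnertonDyer.BirchSwinnertonDyer.Theorems.ManinLocalTwoThreeKummerCubeAnalyticDictionary
import HarnessLib

/-!
# The `p = 2` twin of leaf S1: the formal/analytic dictionary for the Kummer SQUARE series `Ξ_T = z²(x∘φ − x(T))` (S1₂)
# (route `ManinLocalTwoThree`, crux C2 `ManinOddAtFour` stmt-BirchSwinnertonDyer-22967; cell bsd-f2-manin, p2 gen 16 — generic leaf offered to the
# planners' `p = 2` Kummer-square line for C2 v21 `stub_cuspidalKummerOddExponentOnCore`; the machinery is planner `-an` g37's S1
# (`Theorems/ManinLocalTwoThreeKummerCubeAnalytic{Taylor,LocalParam,Dictionary}.lean`), applied to `g − e_s·t²` instead of the tangent-line germ)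

`kummerSquareAnalyticDictionary`: for a parametrisation datum `D` with `c ≠ 0`, THE formal germ `z` (`IsParamGerm W c a z`) and any `e : ℚ`,
the `2`-torsion Kummer series `kummerSeries W c e z = X_E(z) − e_s·z²` (`e_s = shortRoot W c e`, `X_E = formalXMulSq` of the short model
`E_{W,c}`) converges for `Im τ > B` to the Kummer SQUARE FUNCTION `t_s(τ)²·(x_s(τ) − e_s)` (`shortT`, `shortX` of `KummerCubeMonodromy`).
Proof: the analytic germ is `H ∘ ε` with `H = locG − e_s·locT²` (`locG = t²x`, `locT = t` along the uniformisation of `E_{W,c}/ℂ` by the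
homothetic Néron pair `c⁻¹Λ`, `isNeron_shortModel`) and `ε = qGerm f`; `𝓣[H] = formalXMulSq(exp_V) − e_s·exp_V²` (`taylorAt0_locG`,
`taylorAt0_locT` = the Bost identification), `𝓣[H ∘ ε] = 𝓣[H].subst 𝓣[ε]` (`taylorAt0_comp`), `exp_V(Σ aₙqⁿ/n) = z_ℂ` (`IsParamGerm`,
`formalExp_subst_formalLog`), so `𝓣[H ∘ ε] = (kummerSeries).map ℚ→ℂ`; Taylor's theorem on a small ball (`exists_hasSum_taylorAt0`) and
`exists_im_bound` finish.  Also recorded: `kummerSquareFunction_eq_loc` (the value identity off `c⁻¹Λ`) and `taylorAt0_locKummerSq`.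
HONEST FRAMING: a routine analytic leaf; nothing about BSD or Manin's conjecture is proved; C2 remains OPEN.
[cite: SilvermanAEC2009, IV.1 (formal group expansions; shape)] [cite: Bost2001AlgebraicLeaves, §3.4.1 (formal vs analytic leaves; shape)]
-/

set_option autoImplicit false
-- lint-debt: the directory name repeats the summit name (sibling precedent `ManinLocalTwoThreeKummerCubeAnalyticDictionary.lean`)
set_option linter.dupNamespace false

noncomputable section

open Complex Filter Topology PowerSeries CongruenceSubgroup
open scoped PeriodPair UpperHalfPlane MatrixGroups ModularForm Nat Classical
open WeierstrassCurve Literature.NumberTheory.EllipticCurves Literature.NumberTheory.EllipticCurves.ModularForms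
open Literature.NumberTheory.Transcendental.AndreCriterion UpperHalfPlane
open Summit.BirchSwinnertonDyer.Rank1Residual.ManinAdditive.CuspidalKummer
open Summit.BirchSwinnertonDyer.Rank1Residual.ManinAdditive.KummerCubeMonodromy

namespace Summit.BirchSwinnertonDyer.BirchSwinnertonDyer.Theorems.ManinLocalTwoThree.KummerCubeAnalytic

/-- `𝓣[g − e·t²] = formalXMulSq(exp_V) − e·exp_V²` for the local-parameter germs `g = locG`, `t = locT`. [folklore] -/
theorem taylorAt0_locKummerSq (L : PeriodPair) (V : WeierstrassCurve ℂ) (h₂ : L.g₂ = V.c₄ / 12)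
    (h₃ : L.g₃ = V.c₆ / 216) (e : ℂ) :
    taylorAt0 (fun z => locG L V z - e * locT L V z ^ 2) =
      V.formalXMulSq.subst V.formalExp - C e * V.formalExp ^ 2 := by
  have hga := analyticAt_locG L V
  have hta := analyticAt_locT L V
  set g := locG L V with hg
  set t := locT L V with ht
  have hfun : (fun z => g z - e * t z ^ 2) = g - (fun z => e * (t ^ 2) z) := by
    funext z
    simp only [Pi.sub_apply, Pi.pow_apply]
  have a2 : AnalyticAt ℂ (fun z => e * (t ^ 2) z) 0 := analyticAt_const.fun_mul (hta.pow 2)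
  have hTg : taylorAt0 g = V.formalXMulSq.subst V.formalExp := taylorAt0_locG L V h₂ h₃
  have hTt : taylorAt0 t = V.formalExp := taylorAt0_locT L V h₂ h₃
  rw [hfun]
  simp only [taylorAt0] at hTg hTt ⊢
  rw [Literature.NumberTheory.EllipticCurves.taylor_sub hga a2, taylor_const_mul, taylor_pow hta 2, hTg, hTt]

/-- Off the lattice `c⁻¹Λ`, the Kummer square function `t_s²·(x_s − e_s)` is the germ `g − e_s·t²` of the short model at `E_f(τ)`
(homothety `℘_{c⁻¹Λ}(u) = c²℘_Λ(cu)`, `℘'_{c⁻¹Λ}(u) = c³℘'_Λ(cu)`). [folklore] -/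
theorem kummerSquareFunction_eq_loc (W : WeierstrassCurve ℚ) {N : ℕ} [NeZero N]
    (D : ModularParametrizationData W N) (hc : (D.c : ℂ) ≠ 0) (eC : ℂ) (τ : ℍ)
    (hτ : eichlerIntegral D.f τ ∉ (D.L.mulLeft ((D.c : ℂ)⁻¹) (inv_ne_zero hc)).lattice) :
    shortT D τ ^ 2 * (shortX D τ - eC) =
      locG (D.L.mulLeft ((D.c : ℂ)⁻¹) (inv_ne_zero hc)) ((shortModel W D.c).map (algebraMap ℚ ℂ)) (eichlerIntegral D.f τ) -
        eC * locT (D.L.mulLeft ((D.c : ℂ)⁻¹) (inv_ne_zero hc)) ((shortModel W D.c).map (algebraMap ℚ ℂ))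
          (eichlerIntegral D.f τ) ^ 2 := by
  set L' := D.L.mulLeft ((D.c : ℂ)⁻¹) (inv_ne_zero hc) with hL'
  set u := eichlerIntegral D.f τ with hu
  have hP : ℘[L'] u = (D.c : ℂ) ^ 2 * ℘[D.L] ((D.c : ℂ) * u) := by
    have h := PeriodPair.weierstrassP_mulLeft ((D.c : ℂ)⁻¹) (inv_ne_zero hc) D.L ((D.c : ℂ) * u)
    rw [inv_mul_cancel_left₀ hc, inv_pow, inv_inv] at h
    exact h
  have hP' : ℘'[L'] u = (D.c : ℂ) ^ 3 * ℘'[D.L] ((D.c : ℂ) * u) := by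
    have h := PeriodPair.derivWeierstrassP_mulLeft ((D.c : ℂ)⁻¹) (inv_ne_zero hc) D.L ((D.c : ℂ) * u)
    rw [inv_mul_cancel_left₀ hc, inv_pow, inv_inv] at h
    exact h
  have ha₁ : ((shortModel W D.c).map (algebraMap ℚ ℂ)).a₁ = 0 := by simp [shortModel]
  have ha₃ : ((shortModel W D.c).map (algebraMap ℚ ℂ)).a₃ = 0 := by simp [shortModel]
  have hb₂ : ((shortModel W D.c).map (algebraMap ℚ ℂ)).b₂ = 0 := by
    simp [shortModel, WeierstrassCurve.b₂]
  simp only [shortT, shortX, shortY, locG, locT, if_neg hτ, ha₁, ha₃, hb₂,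
    zero_div, sub_zero, zero_mul, ← hu, hP, hP']
  by_cases hy : ℘'[D.L] ((D.c : ℂ) * u) = 0
  · rw [hy]; simp
  · field_simp

/-- **S1₂ — the formal/analytic dictionary for the Kummer SQUARE series**: for `Im τ` large,
`t_s(τ)²·(x_s(τ) − e_s) = Σₙ coeffₙ(kummerSeries W c e z)·q(τ)ⁿ` with `e_s = shortRoot W c e`. [folklore] -/
theorem kummerSquareAnalyticDictionary :
    ∀ (W : WeierstrassCurve ℚ) [W.IsElliptic] [W.IsGloballyMinimal] {N : ℕ} [NeZero N]
      (D : ModularParametrizationData W N) (a : ℕ → ℤ), (∀ n, (a n : ℂ) = cuspCoeff D.f n) → D.c ≠ 0 →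
      ∀ (e : ℚ) (z : ℚ⟦X⟧), IsParamGerm W D.c a z →
      ∃ B : ℝ, ∀ τ : ℍ, B < τ.im →
        HasSum (fun n : ℕ ↦ ((coeff n (kummerSeries W D.c e z) : ℚ) : ℂ) * Function.Periodic.qParam 1 (τ : ℂ) ^ n)
          (shortT D τ ^ 2 * (shortX D τ - ((shortRoot W D.c e : ℚ) : ℂ))) := by
  intro W _ _ N _ D a ha hc e z hz
  have hcC : (D.c : ℂ) ≠ 0 := by exact_mod_cast hc
  set L' := D.L.mulLeft ((D.c : ℂ)⁻¹) (inv_ne_zero hcC) with hL'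
  set V := (shortModel W D.c).map (algebraMap ℚ ℂ) with hV
  set eC : ℂ := ((shortRoot W D.c e : ℚ) : ℂ) with heC
  obtain ⟨h₂, h₃⟩ := isNeron_shortModel W D hcC
  rw [← hL', ← hV] at h₂ h₃
  -- the analytic germ `K = H ∘ ε` in the variable `q`
  set H : ℂ → ℂ := fun w => locG L' V w - eC * locT L' V w ^ 2 with hH
  set K : ℂ → ℂ := H ∘ qGerm D.f with hK
  have hε := analyticAt_qGerm D.f
  have hε0 := qGerm_zero D.f
  have hHa : AnalyticAt ℂ H 0 := by
    have hg := analyticAt_locG L' V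
    have ht := analyticAt_locT L' V
    rw [hH]
    exact hg.sub (analyticAt_const.mul (ht.pow 2))
  have hKa : AnalyticAt ℂ K 0 := by
    have h' : AnalyticAt ℂ H (qGerm D.f 0) := by rw [hε0]; exact hHa
    exact h'.comp hε
  obtain ⟨r, hr, hsum⟩ := exists_hasSum_taylorAt0 hKa
  obtain ⟨B, hB⟩ := exists_im_bound W D hcC hr
  -- the Taylor series of `K` is `kummerSeries` (base-changed to `ℂ`)
  have hE0 : constantCoeff V.formalExp = 0 := V.constantCoeff_formalExp
  have hsE : HasSubst V.formalExp := HasSubst.of_constantCoeff_zero' hE0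
  set zC : PowerSeries ℂ := z.map (algebraMap ℚ ℂ) with hzC
  have hz0 : constantCoeff zC = 0 := by
    rw [hzC, ← coeff_zero_eq_constantCoeff_apply, coeff_map, coeff_zero_eq_constantCoeff_apply, hz.1,
      map_zero]
  have hsz : HasSubst zC := HasSubst.of_constantCoeff_zero' hz0
  have hszQ : HasSubst z := HasSubst.of_constantCoeff_zero' hz.1
  set ℓ : PowerSeries ℂ := PowerSeries.mk fun n => cuspCoeff D.f n / n with hℓ
  -- `ℓ = log_V(zC)` (from `IsParamGerm`, base-changed)
  have hlog : V.formalLog.subst zC = ℓ := by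
    have h := congrArg (PowerSeries.map (algebraMap ℚ ℂ)) hz.2
    rw [map_subst_univ hszQ, WeierstrassCurve.map_formalLog] at h
    rw [hV, hzC, h, hℓ]
    ext n
    rw [coeff_map, lSeriesLog, coeff_mk, coeff_mk, ← ha n]
    simp
  have hsL : HasSubst V.formalLog := HasSubst.of_constantCoeff_zero' V.constantCoeff_formalLog
  -- `exp_V(ℓ) = zC`
  have hexp : V.formalExp.subst ℓ = zC := by
    rw [← hlog, ← PowerSeries.subst_comp_subst_apply hsL hsz, V.formalExp_subst_formalLog,
      PowerSeries.subst_X hsz]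
  have hsℓ : HasSubst ℓ := HasSubst.of_constantCoeff_zero' (by
    rw [hℓ, ← coeff_zero_eq_constantCoeff_apply, coeff_mk]; simp)
  have hT : taylorAt0 K = (kummerSeries W D.c e z).map (algebraMap ℚ ℂ) := by
    rw [hK, taylorAt0_comp hHa hε hε0, hH, taylorAt0_locKummerSq L' V h₂ h₃ eC, taylorAt0_qGerm, ← hℓ]
    have hsXq : (shortModel W D.c).formalXMulSq.map (algebraMap ℚ ℂ) = V.formalXMulSq := by
      rw [hV, WeierstrassCurve.map_formalXMulSq]
    have hrhs : (kummerSeries W D.c e z).map (algebraMap ℚ ℂ) = V.formalXMulSq.subst zC - C eC * zC ^ 2 := by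
      rw [kummerSeries, smul_eq_C_mul]
      simp only [map_sub, map_mul, map_pow, PowerSeries.map_C, map_subst_univ hszQ, hsXq, ← hzC, eq_ratCast, heC]
    rw [hrhs, ← coe_substAlgHom hsℓ]
    simp only [map_sub, map_mul, map_pow, Literature.NumberTheory.EllipticCurves.substAlgHom_C hsℓ, coe_substAlgHom]
    rw [PowerSeries.subst_comp_subst_apply hsE hsℓ, hexp]
  refine ⟨B, fun τ hτ => ?_⟩
  obtain ⟨hτΛ, hτq⟩ := hB τ hτ
  have hS := hsum _ hτq
  have hKq : K (Function.Periodic.qParam 1 (τ : ℂ)) = shortT D τ ^ 2 * (shortX D τ - eC) := by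
    rw [hK, Function.comp_apply, qGerm_apply, hH]
    exact (kummerSquareFunction_eq_loc W D hcC eC τ hτΛ).symm
  rw [hKq, hT] at hS
  have hfun : (fun n : ℕ => ((coeff n (kummerSeries W D.c e z) : ℚ) : ℂ) *
      Function.Periodic.qParam 1 (τ : ℂ) ^ n) =
      fun n : ℕ => coeff n ((kummerSeries W D.c e z).map (algebraMap ℚ ℂ)) *
        Function.Periodic.qParam 1 (τ : ℂ) ^ n := by
    funext n
    rw [coeff_map, eq_ratCast]
  rw [hfun]
  exact hS

end Summit.BirchSwinnertonDyer.BirchSwinnertonDyer.Theorems.ManinLocalTwoThree.KummerCubeAnalytic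

end
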